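import Literature.Computability.AlgebraicComplexity.AndrewsForbes2022Applications
import Literature.Computability.AlgebraicComplexity.AndrewsForbes2022DeterminantalIdeals
import Literature.Computability.AlgebraicComplexity.DepthThreeChasmCircuits
import Literature.Computability.AlgebraicComplexity.CircuitGateSemantics
import Literature.Computability.AlgebraicComplexity.RealTauConjectureDepthFour
import HarnessLib

/-!
# Affine composition of arithmetic circuits, and the closure of the border of low-depth circuits
# under the depth-three oracle reductions of Andrews–Forbes 2022 (Thm. 3.8 ⇒ Lemma 6.6's step)

Source for the application: R. Andrews, M. A. Forbes, STOC 2022 = arXiv:2112.00792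
[`AndrewsForbes2022`], proof of Lemma 6.6 (p0033:L49–L51): "Using (cor:proj to imm), we obtain a
circuit `Ψ(y)` of size `s + O(n²m²)` and product-depth `Δ` that computes `IMM_{w,d}(y) + O(ε)`" —
i.e. the border of small product-depth-`Δ` circuits is closed under the depth-three single-oracle
reductions of Thm. 3.8 (`DepthThreeOracleComputes h g`: `u · h(a(y), ε^{N+1}) + v = g + O(ε)` with
affine forms `a`). This is the "composition calculus for `productDepthEdgeClass`" recorded as
missing in `AndrewsForbes2022Applications.lean` ("NOT typed here"), in the generality needed for
Lemmas 6.6/6.7 (and Thm. 6.8's iteration). val-lit t24.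

## Content (all proved; the `def`s are plumbing, no named facts)

Generic part (namespace `ArithCircuit`, tree model of `ArithCircuit.lean` / `CircuitDepth.lean`,
size = WIRES `edgeSize`, `productDepth`):
* `ArithCircuit.affineGate q` — ONE unbounded-fan-in sum gate `c₀ · 1 + Σ_i c_i x_i` computing an
  affine polynomial `q` (`totalDegree q ≤ 1`; `eq_C_add_sum_of_totalDegree_le_one`), fan-in
  `|ι| + 1`, product-depth `0`;
* `ArithCircuit.affineComp U A P cu cv` — the circuit `cu · P(A(y)) + cv`: a prefix of affine
  gates `A x` for `x ∈ U` (`U ⊇` the variables occurring in `P`), the gates of `P` transported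
  (`Operand.compOp` / `Gate.compOp`: variables ↦ references to the prefix, gate references
  shifted), one affine output gate. `eval_affineComp` (`= C cu * aeval A P.eval + C cv`),
  `edgeSize_affineComp` (`= |U| (|ι|+1) + wires(P) + 2`), `productDepth_affineComp` (`=` that of
  `P`: affine gates are sum gates);
* change of coefficients (`ArithCircuit.map`, semantics `ArithCircuit.eval_map_apply` of
  `RealTauConjectureDepthFour.lean`): `edgeSize_mapCoeff`, `productDepth_mapCoeff` (wires and
  product-depth are kept);
* fold lemmas `gateValues_append_map_comp`, `gateWDepths_append_map_comp` (a prefix followed by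
  transported gates), `gateValues_eq_map_of_forall`, `gateWDepths_eq_replicate_of_forall`.

Application: **`borderClass_of_depthThreeOracleComputes`** — if `h ∈ F((ε))[X_σ]` is computed by
a circuit of product-depth `≤ Δ` with `s` wires and `DepthThreeOracleComputes h g` (`g ∈ F[y_ι]`),
then `g ∈ borderClass F (productDepthEdgeClass F((ε)) ι ((s+1)(|ι|+1) + s + 2) Δ)`: substitute
`ε ↦ ε^{N+1}` in the coefficients (`ArithCircuit.map (epsPow F N)`), feed the `≤ s + 1` used
variables (`DepthThreeChasm.usedVars`, `card_usedVars_le`) by affine gates, add the output gate.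
With `AndrewsForbes2022_cor_3_10_holds` and `AndrewsForbes2022_cor_6_5_explicit`
(`AndrewsForbes2022BorderLST.lean`) this is the skeleton of Lemma 6.6 (remaining: the explicit
exponent `δ(Δ) ≥ 7^{-Δ}/4` behind Lemma 6.6's universal constant, and the asymptotics).

Honest framing: circuit-model bookkeeping and a reduction between typed literature statements;
VP ≠ VNP is NOT proved.

## References

* [AndrewsForbes2022] R. Andrews, M. A. Forbes, STOC 2022, arXiv:2112.00792, Thm. 3.8 (first
  bullet: the depth-three oracle circuit), Lemma 6.6 (proof, p0033:L49–L51).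
* [Burgisser2000] P. Bürgisser, *Completeness and Reduction in Algebraic Complexity Theory*, 2000,
  Def. 2.1, §4.1 (the model; change of coefficients).
-/

noncomputable section

open MvPolynomial

namespace Literature.Computability.AlgebraicComplexity

universe u v w

namespace ArithCircuit

variable {k : Type u} [CommSemiring k] {σ : Type v} {ι : Type w}

/-! ### Affine polynomials as single sum gates -/

/-- An exponent vector that is neither `0` nor a `single i 1` has degree `≥ 2`. [cite: Burgisser2000, Def. 2.1] -/
theorem two_le_sum_of_ne_single {m : ι →₀ ℕ} (h0 : m ≠ 0) (h1 : ∀ i, Finsupp.single i 1 ≠ m) :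
    2 ≤ m.sum fun _ e => e := by
  classical
  obtain ⟨i, hi⟩ : ∃ i, m i ≠ 0 := by
    by_contra h
    push Not at h
    exact h0 (Finsupp.ext h)
  have hi' : i ∈ m.support := Finsupp.mem_support_iff.2 hi
  unfold Finsupp.sum
  show 2 ≤ ∑ a ∈ m.support, m a
  by_cases h2 : 2 ≤ m i
  · exact h2.trans (Finset.single_le_sum (f := fun j => m j) (fun _ _ => Nat.zero_le _) hi')
  · have hmi : m i = 1 := by omega
    obtain ⟨j, hji, hj⟩ : ∃ j, j ≠ i ∧ m j ≠ 0 := by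
      by_contra h
      push Not at h
      apply h1 i
      ext j'
      by_cases hj' : j' = i
      · subst hj'; rw [Finsupp.single_eq_same, hmi]
      · rw [Finsupp.single_apply, if_neg (fun h' => hj' h'.symm), h j' hj']
    have hj'' : j ∈ m.support := Finsupp.mem_support_iff.2 hj
    have := Finset.add_le_sum (f := fun j => m j) (fun _ _ => Nat.zero_le _) hi' hj'' (Ne.symm hji)
    have : 1 ≤ m j := Nat.one_le_iff_ne_zero.2 hj
    omega

/-- A polynomial of total degree `≤ 1` is `c₀ + Σ_i c_i x_i`. [cite: Burgisser2000, Def. 2.1] -/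
theorem eq_C_add_sum_of_totalDegree_le_one [Fintype ι] [DecidableEq ι] (q : MvPolynomial ι k)
    (hq : q.totalDegree ≤ 1) :
    q = C (coeff 0 q) + ∑ i : ι, coeff (Finsupp.single i 1) q • X i := by
  classical
  ext m
  simp only [coeff_add, coeff_C, coeff_sum, coeff_smul, coeff_X, smul_eq_mul, mul_ite, mul_one,
    mul_zero]
  by_cases hm0 : m = 0
  · subst hm0
    simp only [if_true]
    rw [Finset.sum_eq_zero (fun i _ => by rw [if_neg (Finsupp.single_ne_zero.2 one_ne_zero)]), add_zero]
  rw [if_neg (Ne.symm hm0), zero_add]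
  by_cases hms : ∃ i, Finsupp.single i 1 = m
  · obtain ⟨i, rfl⟩ := hms
    rw [Finset.sum_eq_single i]
    · rw [if_pos rfl]
    · intro j _ hji
      rw [if_neg]
      intro h
      exact hji (Finsupp.single_left_injective one_ne_zero h)
    · intro h; exact absurd (Finset.mem_univ i) h
  · rw [Finset.sum_eq_zero (fun i _ => by rw [if_neg (fun h => hms ⟨i, h⟩)])]
    -- `m` has degree `≥ 2`, so its coefficient vanishes
    by_contra hne
    have hmem : m ∈ q.support := by
      rw [mem_support_iff]; exact fun h => hne (by rw [h])
    have hdeg := (le_totalDegree hmem).trans hq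
    unfold Finsupp.sum at hdeg
    simp only [] at hdeg
    have h2 := two_le_sum_of_ne_single hm0 (fun i h => hms ⟨i, h⟩)
    unfold Finsupp.sum at h2
    have h2' : 2 ≤ ∑ x ∈ m.support, m x := h2
    omega

/-- The sum gate `c₀ · 1 + Σ_i c_i · x_i` reading off an affine polynomial `q` (fan-in `|ι| + 1`,
no gate references). [folklore] -/
def affineGate [Fintype ι] [DecidableEq ι] (q : MvPolynomial ι k) : Gate k ι :=
  .sum ((coeff 0 q, .const 1) ::
    (Finset.univ : Finset ι).toList.map fun i => (coeff (Finsupp.single i 1) q, .var i))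

/-- Circuit-model bookkeeping (`fanIn_affineGate`). [cite: Burgisser2000, Def. 2.1] -/
theorem fanIn_affineGate [Fintype ι] [DecidableEq ι] (q : MvPolynomial ι k) :
    (affineGate q).fanIn = Fintype.card ι + 1 := by
  simp [affineGate, Gate.fanIn, Gate.args]

/-- Circuit-model bookkeeping (`isProd_affineGate`). [cite: Burgisser2000, Def. 2.1] -/
theorem isProd_affineGate [Fintype ι] [DecidableEq ι] (q : MvPolynomial ι k) :
    (affineGate q).isProd = false := rfl

/-- The affine gate computes `q`, against any value list. [cite: Burgisser2000, Def. 2.1] -/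
theorem eval_affineGate [Fintype ι] [DecidableEq ι] (q : MvPolynomial ι k) (hq : q.totalDegree ≤ 1)
    (vals : List (MvPolynomial ι k)) : (affineGate q).eval vals = q := by
  conv_rhs => rw [eq_C_add_sum_of_totalDegree_le_one q hq]
  simp only [affineGate, Gate.eval, List.map_cons, List.map_map, Function.comp_def, Operand.eval,
    List.sum_cons]
  rw [← List.sum_toFinset _ (Finset.nodup_toList _), Finset.toList_toFinset]
  congr 1
  rw [smul_eq_C_mul, C_1, mul_one]

/-- The affine gate has depth `w (affineGate q)` + 0 (all its operands are leaves). [cite: Burgisser2000, Def. 2.1] -/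
theorem foldr_depthIn_affineGate [Fintype ι] [DecidableEq ι] (q : MvPolynomial ι k) (ds : List ℕ) :
    ((affineGate q).args.map (Operand.depthIn ds)).foldr max 0 = 0 := by
  simp only [affineGate, Gate.args, List.map_cons, List.map_map, Function.comp_def, Operand.depthIn,
    List.foldr_cons, Nat.zero_max]
  induction (Finset.univ : Finset ι).toList with
  | nil => rfl
  | cons a l ih => simpa using ih

/-! ### The composed circuit -/

/-- Value list of a list of *leaf gates* (gates whose value does not depend on earlier values).
[cite: Burgisser2000, Def. 2.1] -/
theorem gateValues_eq_map_of_forall (gs : List (Gate k ι)) (v : Gate k ι → MvPolynomial ι k)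
    (h : ∀ g ∈ gs, ∀ vals, g.eval vals = v g) : gateValues gs = gs.map v := by
  induction gs using List.reverseRecOn with
  | nil => rfl
  | append_singleton gs g ih =>
    rw [gateValues_append_singleton, ih (fun g' hg' => h g' (by simp [hg'])),
      h g (by simp), List.map_append, List.map_singleton]

omit [CommSemiring k] in
/-- Depth list of a list of gates all of whose operands are leaves and whose weight is `0`.
[cite: Burgisser2000, Def. 2.1] -/
theorem gateWDepths_eq_replicate_of_forall (w : Gate k ι → ℕ) (gs : List (Gate k ι))
    (hw : ∀ g ∈ gs, w g = 0)
    (h : ∀ g ∈ gs, ∀ ds, (g.args.map (Operand.depthIn ds)).foldr max 0 = 0) :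
    gateWDepths w gs = List.replicate gs.length 0 := by
  induction gs using List.reverseRecOn with
  | nil => rfl
  | append_singleton gs g ih =>
    rw [gateWDepths_append_singleton, ih (fun g' hg' => hw g' (by simp [hg']))
      (fun g' hg' => h g' (by simp [hg'])), hw g (by simp), h g (by simp), List.length_append,
      List.length_singleton, List.replicate_succ', Nat.zero_add]

section Compose

variable (U : Finset σ) (A : σ → MvPolynomial ι k) [Fintype ι] [DecidableEq ι] [DecidableEq σ]

/-- Index of the prefix gate computing `A x`, for `x ∈ U` (junk `0` otherwise). [folklore] -/
def pfxIdx (x : σ) : ℕ := if h : x ∈ U then (U.equivFin ⟨x, h⟩ : ℕ) else 0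

/-- The prefix: one affine gate per `x ∈ U`, computing `A x`. [folklore] -/
def prefixGates : List (Gate k ι) :=
  List.ofFn fun i : Fin U.card => affineGate (A (U.equivFin.symm i : U))

/-- Operand transport into the composed circuit: a variable `x ∈ U` becomes a reference to its
prefix gate, gate references are shifted past the prefix. [folklore] -/
def Operand.compOp (off : ℕ) : Operand k σ → Operand k ι
  | .var x => if x ∈ U then .gate (pfxIdx U x) else .const 0
  | .const c => .const c
  | .gate j => .gate (j + off)

/-- Gate transport into the composed circuit. [folklore] -/
def Gate.compOp (off : ℕ) : Gate k σ → Gate k ι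
  | .sum args => .sum (args.map fun a => (a.1, a.2.compOp U off))
  | .prod args => .prod (args.map (Operand.compOp U off))

/-- **Affine composition**: the circuit `cu · P(A(y)) + cv` — the prefix of affine gates `A x`
(`x ∈ U ⊇` the variables of `P`), the gates of `P` reading the prefix instead of the variables,
and one affine output gate. [folklore] -/
def affineComp (P : ArithCircuit k σ) (cu cv : k) : ArithCircuit k ι where
  gates := (prefixGates U A ++ P.gates.map (Gate.compOp U U.card)) ++
    [.sum [(cu, P.output.compOp U U.card), (cv, .const 1)]]
  output := .gate (U.card + P.size)

variable {U A}

omit [Fintype ι] [DecidableEq ι] in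
/-- Circuit-model bookkeeping (`Gate.args_compOp`). [cite: Burgisser2000, Def. 2.1] -/
theorem Gate.args_compOp (off : ℕ) (g : Gate k σ) :
    (g.compOp U off : Gate k ι).args = g.args.map (Operand.compOp U off) := by
  cases g <;> simp [Gate.compOp, Gate.args, List.map_map, Function.comp_def]

omit [Fintype ι] [DecidableEq ι] in
/-- Circuit-model bookkeeping (`Gate.fanIn_compOp`). [cite: Burgisser2000, Def. 2.1] -/
@[simp] theorem Gate.fanIn_compOp (off : ℕ) (g : Gate k σ) :
    (g.compOp U off : Gate k ι).fanIn = g.fanIn := by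
  simp [Gate.fanIn, Gate.args_compOp]

omit [Fintype ι] [DecidableEq ι] in
/-- Circuit-model bookkeeping (`Gate.isProd_compOp`). [cite: Burgisser2000, Def. 2.1] -/
@[simp] theorem Gate.isProd_compOp (off : ℕ) (g : Gate k σ) :
    (g.compOp U off : Gate k ι).isProd = g.isProd := by
  cases g <;> rfl

omit [DecidableEq σ] in
/-- Circuit-model bookkeeping (`length_prefixGates`). [cite: Burgisser2000, Def. 2.1] -/
theorem length_prefixGates : (prefixGates U A).length = U.card := by
  simp [prefixGates]

/-- Circuit-model bookkeeping (`pfxIdx_lt`). [cite: Burgisser2000, Def. 2.1] -/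
theorem pfxIdx_lt {x : σ} (hx : x ∈ U) : pfxIdx U x < U.card := by
  unfold pfxIdx; rw [dif_pos hx]; exact Fin.is_lt _

omit [DecidableEq σ] in
/-- The values of the prefix gates. [cite: Burgisser2000, Def. 2.1] -/
theorem gateValues_prefixGates (hA : ∀ x, (A x).totalDegree ≤ 1) :
    gateValues (prefixGates U A) = List.ofFn fun i : Fin U.card => A (U.equivFin.symm i : U) := by
  unfold prefixGates
  rw [gateValues_eq_map_of_forall _ (fun g => g.eval [])
    (fun g hg vals => by
      obtain ⟨i, rfl⟩ := List.mem_ofFn.1 hg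
      rw [eval_affineGate _ (hA _), eval_affineGate _ (hA _)]),
    List.map_ofFn]
  congr 1
  funext i
  simp only [Function.comp_apply]
  rw [eval_affineGate _ (hA _)]

/-- The prefix value at the index of `x ∈ U` is `A x`. [cite: Burgisser2000, Def. 2.1] -/
theorem getD_gateValues_prefixGates (hA : ∀ x, (A x).totalDegree ≤ 1) {x : σ} (hx : x ∈ U)
    (W : List (MvPolynomial ι k)) :
    (gateValues (prefixGates U A) ++ W).getD (pfxIdx U x) 0 = A x := by
  rw [List.getD_eq_getElem?_getD, List.getElem?_append_left (by
    rw [gateValues_length, length_prefixGates]; exact pfxIdx_lt hx), gateValues_prefixGates hA,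
    List.getElem?_ofFn]
  unfold pfxIdx
  rw [dif_pos hx]
  simp

/-- **Operand transport is semantic** (for operands whose variable lies in `U`). [cite: Burgisser2000, Def. 2.1] -/
theorem Operand.eval_compOp (hA : ∀ x, (A x).totalDegree ≤ 1) (vals : List (MvPolynomial σ k))
    (u : Operand k σ) (hu : ∀ x, u = .var x → x ∈ U) :
    (u.compOp U U.card : Operand k ι).eval
        (gateValues (prefixGates U A) ++ vals.map (aeval A)) = aeval A (u.eval vals) := by
  cases u with
  | var x =>
    have hx := hu x rfl
    simp only [Operand.compOp, if_pos hx, Operand.eval, aeval_X]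
    exact getD_gateValues_prefixGates hA hx _
  | const c => simp [Operand.compOp, Operand.eval]
  | gate j =>
    simp only [Operand.compOp, Operand.eval]
    rw [List.getD_eq_getElem?_getD, List.getElem?_append_right (by
      rw [gateValues_length, length_prefixGates]; omega), gateValues_length, length_prefixGates,
      Nat.add_sub_cancel, List.getElem?_map, List.getD_eq_getElem?_getD]
    cases vals[j]? <;> simp

/-- **Gate transport is semantic** (for gates whose variables lie in `U`). [cite: Burgisser2000, Def. 2.1] -/
theorem Gate.eval_compOp (hA : ∀ x, (A x).totalDegree ≤ 1) (vals : List (MvPolynomial σ k))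
    (g : Gate k σ) (hg : ∀ x, Operand.var x ∈ g.args → x ∈ U) :
    (g.compOp U U.card : Gate k ι).eval (gateValues (prefixGates U A) ++ vals.map (aeval A)) =
      aeval A (g.eval vals) := by
  cases g with
  | sum args =>
    simp only [Gate.compOp, Gate.eval, List.map_map, map_list_sum]
    congr 1
    refine List.map_congr_left fun a ha => ?_
    simp only [Function.comp_apply, map_smul]
    rw [Operand.eval_compOp hA vals a.2 (fun x hx => hg x ?_)]
    simp only [Gate.args, List.mem_map]
    exact ⟨a, ha, hx⟩
  | prod args =>
    simp only [Gate.compOp, Gate.eval, List.map_map, map_list_prod]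
    congr 1
    refine List.map_congr_left fun a ha => ?_
    simp only [Function.comp_apply]
    exact Operand.eval_compOp hA vals a (fun x hx => hg x (by rw [← hx]; exact ha))

omit [Fintype ι] [DecidableEq ι] [DecidableEq σ] in
/-- Value list of a prefix followed by transported gates (type-changing variant of
`gateValues_append_map_of_eval_map`). [cite: Burgisser2000, Def. 2.1] -/
theorem gateValues_append_map_comp (pre : List (Gate k ι)) (T : Gate k σ → Gate k ι)
    (φ : MvPolynomial σ k → MvPolynomial ι k) (gs : List (Gate k σ))
    (hT : ∀ g ∈ gs, ∀ vals, (T g).eval (gateValues pre ++ vals.map φ) = φ (g.eval vals)) :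
    gateValues (pre ++ gs.map T) = gateValues pre ++ (gateValues gs).map φ := by
  induction gs using List.reverseRecOn with
  | nil => simp [gateValues]
  | append_singleton gs g ih =>
    rw [List.map_append, List.map_singleton, ← List.append_assoc, gateValues_append_singleton,
      ih (fun g' hg' => hT g' (by simp [hg'])), hT g (by simp), gateValues_append_singleton,
      List.map_append, List.map_singleton, List.append_assoc]

omit [CommSemiring k] [Fintype ι] [DecidableEq ι] [DecidableEq σ] in
/-- Depth list of a prefix followed by transported gates. [cite: Burgisser2000, Def. 2.1] -/
theorem gateWDepths_append_map_comp (w : Gate k ι → ℕ) (w₀ : Gate k σ → ℕ) (pre : List (Gate k ι))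
    (T : Gate k σ → Gate k ι) (gs : List (Gate k σ)) (hw : ∀ g ∈ gs, w (T g) = w₀ g)
    (hT : ∀ g ∈ gs, ∀ ds, ((T g).args.map (Operand.depthIn (gateWDepths w pre ++ ds))).foldr max 0 =
      (g.args.map (Operand.depthIn ds)).foldr max 0) :
    gateWDepths w (pre ++ gs.map T) = gateWDepths w pre ++ gateWDepths w₀ gs := by
  induction gs using List.reverseRecOn with
  | nil => simp [gateWDepths]
  | append_singleton gs g ih =>
    rw [List.map_append, List.map_singleton, ← List.append_assoc, gateWDepths_append_singleton,
      ih (fun g' hg' => hw g' (by simp [hg'])) (fun g' hg' => hT g' (by simp [hg'])), hw g (by simp),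
      hT g (by simp), gateWDepths_append_singleton, List.append_assoc]

omit [DecidableEq σ] in
/-- The prefix gates have product-depth `0`. [cite: Burgisser2000, Def. 2.1] -/
theorem gateWDepths_prefixGates :
    gateWDepths prodWeight (prefixGates U A) = List.replicate U.card 0 := by
  rw [gateWDepths_eq_replicate_of_forall _ _ (fun g hg => by
      obtain ⟨i, rfl⟩ := List.mem_ofFn.1 hg; rfl)
    (fun g hg ds => by
      obtain ⟨i, rfl⟩ := List.mem_ofFn.1 hg; exact foldr_depthIn_affineGate _ _), length_prefixGates]

/-- Operand transport keeps depths (the prefix has depth `0`). [cite: Burgisser2000, Def. 2.1] -/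
theorem Operand.depthIn_compOp (ds : List ℕ) (u : Operand k σ) :
    (u.compOp U U.card : Operand k ι).depthIn (gateWDepths prodWeight (prefixGates U A) ++ ds) =
      u.depthIn ds := by
  cases u with
  | var x =>
    simp only [Operand.compOp]
    split_ifs with hx
    · simp only [Operand.depthIn]
      rw [List.getD_eq_getElem?_getD, List.getElem?_append_left (by
        rw [gateWDepths_length, length_prefixGates]; exact pfxIdx_lt hx), gateWDepths_prefixGates,
        List.getElem?_replicate, if_pos (pfxIdx_lt hx)]
      rfl
    · rfl
  | const c => rfl
  | gate j =>
    simp only [Operand.compOp, Operand.depthIn]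
    rw [List.getD_eq_getElem?_getD, List.getElem?_append_right (by
      rw [gateWDepths_length, length_prefixGates]; omega), gateWDepths_length, length_prefixGates,
      Nat.add_sub_cancel, List.getD_eq_getElem?_getD]

variable (U A)

/-- **Semantics of the affine composition**: `affineComp U A P cu cv` computes
`cu · P(A) + cv`, provided every variable of `P` lies in `U` and each `A x` is affine.
[cite: Burgisser2000, Def. 2.1] -/
theorem eval_affineComp (hA : ∀ x, (A x).totalDegree ≤ 1) (P : ArithCircuit k σ) (cu cv : k)
    (hU : ∀ g ∈ P.gates, ∀ x, Operand.var x ∈ g.args → x ∈ U)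
    (hUo : ∀ x, P.output = .var x → x ∈ U) :
    (affineComp U A P cu cv).eval = C cu * aeval A P.eval + C cv := by
  have hmid : gateValues (prefixGates U A ++ P.gates.map (Gate.compOp U U.card)) =
      gateValues (prefixGates U A) ++ (gateValues P.gates).map (aeval A) :=
    gateValues_append_map_comp _ _ _ _ (fun g hg vals => Gate.eval_compOp hA vals g (hU g hg))
  have hlen : (gateValues (prefixGates U A ++ P.gates.map (Gate.compOp U U.card))).length =
      U.card + P.size := by
    rw [hmid, List.length_append, gateValues_length, length_prefixGates, List.length_map,
      gateValues_length]; rfl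
  unfold affineComp ArithCircuit.eval
  rw [Operand.eval_gate, gateValues_append_singleton, List.getD_eq_getElem?_getD,
    List.getElem?_append_right (by rw [hlen]), hlen, Nat.sub_self, List.getElem?_cons_zero,
    Option.getD_some]
  simp only [Gate.eval, List.map_cons, List.map_nil, List.sum_cons, List.sum_nil, add_zero]
  rw [hmid, Operand.eval_compOp hA _ _ hUo, smul_eq_C_mul, smul_eq_C_mul]
  simp only [Operand.eval, C_1, mul_one]

/-- **Wires of the affine composition**: `|U| (|ι| + 1) + wires(P) + 2`. [cite: Burgisser2000, Def. 2.1] -/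
theorem edgeSize_affineComp (P : ArithCircuit k σ) (cu cv : k) :
    (affineComp U A P cu cv).edgeSize = U.card * (Fintype.card ι + 1) + P.edgeSize + 2 := by
  have h1 : ((prefixGates U A).map Gate.fanIn).sum = U.card * (Fintype.card ι + 1) := by
    unfold prefixGates
    rw [List.map_ofFn, List.sum_ofFn]
    simp [fanIn_affineGate]
  have hc : (Gate.fanIn ∘ Gate.compOp U U.card : Gate k σ → ℕ) = Gate.fanIn :=
    funext fun g => Gate.fanIn_compOp (U := U) (ι := ι) _ g
  unfold affineComp ArithCircuit.edgeSize
  rw [List.map_append, List.map_append, List.sum_append, List.sum_append, List.map_map, hc, h1]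
  simp [Gate.fanIn, Gate.args]

/-- **Product-depth of the affine composition**: the same as `P`'s (affine gates are sum gates).
[cite: Burgisser2000, Def. 2.1] -/
theorem productDepth_affineComp (P : ArithCircuit k σ) (cu cv : k) :
    (affineComp U A P cu cv).productDepth = P.productDepth := by
  have hmid : gateWDepths prodWeight (prefixGates U A ++ P.gates.map (Gate.compOp U U.card)) =
      gateWDepths prodWeight (prefixGates U A) ++ gateWDepths prodWeight P.gates :=
    gateWDepths_append_map_comp _ _ _ _ _ (fun g _ => by simp [prodWeight])
      (fun g _ ds => by
        rw [Gate.args_compOp, List.map_map]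
        congr 1
        exact List.map_congr_left fun u _ => Operand.depthIn_compOp ds u)
  have hlen : (gateWDepths prodWeight (prefixGates U A ++ P.gates.map (Gate.compOp U U.card))).length =
      U.card + P.size := by
    rw [hmid, List.length_append, gateWDepths_length, length_prefixGates, gateWDepths_length]; rfl
  rw [productDepth_eq_wdepth_prodWeight, productDepth_eq_wdepth_prodWeight]
  unfold affineComp ArithCircuit.wdepth
  rw [show ∀ (D : List ℕ) (n : ℕ), Operand.depthIn D (.gate n : Operand k ι) = D.getD n 0 from
    fun _ _ => rfl]
  rw [gateWDepths_append_singleton, List.getD_eq_getElem?_getD,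
    List.getElem?_append_right (by rw [hlen]), hlen, Nat.sub_self, List.getElem?_cons_zero,
    Option.getD_some]
  simp only [prodWeight, Gate.isProd, Gate.args, List.map_cons, List.map_nil, List.foldr_cons,
    List.foldr_nil]
  rw [hmid, Operand.depthIn_compOp]
  simp [Operand.depthIn]

end Compose

/-! ### Change of coefficients (`ArithCircuit.map`) : semantics, wires, product-depth -/

section MapCoeff

variable {k' : Type u} [CommSemiring k']

omit [CommSemiring k] [CommSemiring k'] in
/-- Circuit-model bookkeeping (`Gate.args_mapCoeff`). [cite: Burgisser2000, Def. 2.1] -/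
theorem Gate.args_mapCoeff (φ : k → k') (g : Gate k σ) : (g.map φ).args = g.args.map (Operand.map φ) := by
  cases g <;> simp [Gate.map, Gate.args, List.map_map, Function.comp_def]

omit [CommSemiring k] [CommSemiring k'] in
/-- Circuit-model bookkeeping (`Gate.isProd_mapCoeff`). [cite: Burgisser2000, Def. 2.1] -/
@[simp] theorem Gate.isProd_mapCoeff (φ : k → k') (g : Gate k σ) : (g.map φ).isProd = g.isProd := by
  cases g <;> rfl

omit [CommSemiring k] [CommSemiring k'] in
/-- Circuit-model bookkeeping (`Operand.depthIn_mapCoeff`). [cite: Burgisser2000, Def. 2.1] -/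
theorem Operand.depthIn_mapCoeff (φ : k → k') (ds : List ℕ) (u : Operand k σ) :
    (u.map φ).depthIn ds = u.depthIn ds := by
  cases u <;> rfl

/-- Circuit-model bookkeeping (`edgeSize_mapCoeff`). [cite: Burgisser2000, Def. 2.1] -/
@[simp] theorem edgeSize_mapCoeff (φ : k →+* k') (P : ArithCircuit k σ) :
    (P.map φ).edgeSize = P.edgeSize := by
  simp [ArithCircuit.map, ArithCircuit.edgeSize, List.map_map, Function.comp_def, Gate.fanIn_map]

/-- Circuit-model bookkeeping (`gateWDepths_mapCoeff`). [cite: Burgisser2000, Def. 2.1] -/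
theorem gateWDepths_mapCoeff (φ : k →+* k') (gs : List (Gate k σ)) :
    gateWDepths prodWeight (gs.map (Gate.map φ)) = gateWDepths prodWeight gs := by
  induction gs using List.reverseRecOn with
  | nil => rfl
  | append_singleton gs g ih =>
    rw [List.map_append, List.map_singleton, gateWDepths_append_singleton,
      gateWDepths_append_singleton, ih]
    have h1 : prodWeight (g.map (φ : k → k')) = prodWeight g := by simp [prodWeight]
    have h2 : ((g.map (φ : k → k')).args.map (Operand.depthIn (gateWDepths prodWeight gs))) =
        g.args.map (Operand.depthIn (gateWDepths prodWeight gs)) := by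
      rw [Gate.args_mapCoeff, List.map_map]
      exact List.map_congr_left fun u _ => Operand.depthIn_mapCoeff φ _ u
    rw [h1, h2]

/-- Circuit-model bookkeeping (`productDepth_mapCoeff`). [cite: Burgisser2000, Def. 2.1] -/
@[simp] theorem productDepth_mapCoeff (φ : k →+* k') (P : ArithCircuit k σ) :
    (P.map φ).productDepth = P.productDepth := by
  rw [productDepth_eq_wdepth_prodWeight, productDepth_eq_wdepth_prodWeight]
  unfold ArithCircuit.wdepth
  change (P.output.map φ).depthIn (gateWDepths prodWeight (P.gates.map (Gate.map φ))) = _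
  rw [gateWDepths_mapCoeff, Operand.depthIn_mapCoeff]

omit [CommSemiring k] [CommSemiring k'] in
/-- `map` keeps the variable operands (for bookkeeping of used variables). [cite: Burgisser2000, Def. 2.1] -/
theorem Operand.mapCoeff_eq_var_iff (φ : k → k') (u : Operand k σ) (x : σ) :
    u.map φ = .var x ↔ u = .var x := by
  cases u <;> simp [Operand.map]

end MapCoeff

end ArithCircuit

end Literature.Computability.AlgebraicComplexity

/-! ## The closure of the border of low-depth circuits under depth-three oracle reductions -/

namespace Literature.Computability.AlgebraicComplexity

open MvPolynomial ArithCircuit DepthThreeChasm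
open scoped RatFunc LaurentSeries

/-- **The border of small low-depth circuits is closed under the depth-three oracle reductions of
Thm. 3.8** (the step "we obtain a circuit `Ψ` of size `s + O(n²m²)` and product-depth `Δ` that
computes `IMM_{w,d} + O(ε)`" of the proof of Lemma 6.6, p0033:L49–L51, made generic): if
`h ∈ F((ε))[X_σ]` is computed by a circuit of product-depth `≤ Δ` with `s` wires and a depth-three
`h`-oracle circuit computes `g + O(ε)` (`DepthThreeOracleComputes h g`: `u · h(a(y), ε^{N+1}) + v`
with affine `a`), then `g` lies in the closure of product-depth-`Δ` circuits with
`(s+1)(|ι|+1) + s + 2` wires: substitute `ε ↦ ε^{N+1}` in the coefficients (`ArithCircuit.map`),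
feed the `≤ s + 1` used variables by affine sum gates, add one affine output gate
(`ArithCircuit.affineComp`). [cite: AndrewsForbes2022, Lemma 6.6 (proof)] -/
theorem borderClass_of_depthThreeOracleComputes {F : Type} [Field F] {σ ι : Type}
    [Fintype ι] [DecidableEq ι] [DecidableEq σ] {s Δ : ℕ}
    {h : MvPolynomial σ (LaurentSeries F)}
    (hh : h ∈ productDepthEdgeClass (LaurentSeries F) σ s Δ) {g : MvPolynomial ι F}
    (hg : DepthThreeOracleComputes h (MvPolynomial.map (algebraMap F (LaurentSeries F)) g)) :
    g ∈ borderClass F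
      (productDepthEdgeClass (LaurentSeries F) ι ((s + 1) * (Fintype.card ι + 1) + s + 2) Δ) := by
  classical
  obtain ⟨P, hP, hPΔ, hPs⟩ := hh
  obtain ⟨N, a, u, v, ha, hord⟩ := hg
  have ha' : ∀ x, (MvPolynomial.map (algebraMap (RatFunc F) (LaurentSeries F)) (a x)).totalDegree ≤ 1 :=
    fun x => (Finset.sup_mono (support_map_subset _ _)).trans (ha x)
  have hU : ∀ g' ∈ (P.map (epsPow F N)).gates, ∀ x, Operand.var x ∈ g'.args →
      x ∈ usedVars (P.map (epsPow F N)) := fun g' hg' x hx => mem_usedVars_of_mem_args hg' hx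
  have hUo : ∀ x, (P.map (epsPow F N)).output = Operand.var x → x ∈ usedVars (P.map (epsPow F N)) :=
    fun x hx => mem_usedVars_of_output hx
  have hcard : (usedVars (P.map (epsPow F N))).card ≤ s + 1 :=
    (card_usedVars_le _).trans (by rw [edgeSize_mapCoeff]; omega)
  refine ⟨_, ⟨affineComp (usedVars (P.map (epsPow F N)))
    (fun x => MvPolynomial.map (algebraMap (RatFunc F) (LaurentSeries F)) (a x)) (P.map (epsPow F N))
    (algebraMap (RatFunc F) (LaurentSeries F) u) (algebraMap (RatFunc F) (LaurentSeries F) v),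
    rfl, ?_, ?_⟩, ?_⟩
  · rw [productDepth_affineComp, productDepth_mapCoeff]; exact hPΔ
  · rw [edgeSize_affineComp, edgeSize_mapCoeff]
    exact Nat.add_le_add (Nat.add_le_add (Nat.mul_le_mul_right _ hcard) hPs) le_rfl
  · rw [eval_affineComp _ _ ha' _ _ _ hU hUo, eval_map_apply, hP]
    exact hord

end Literature.Computability.AlgebraicComplexity
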